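import Mathlib
import Literature.Analysis.FluidPDE.VectorCalculus
import Literature.Analysis.FluidPDE.WholeSpaceIBP
import Literature.Analysis.FluidPDE.SphereIntegral
import Summits.NavierStokesRegularity.NavierStokesRegularity.Theorems.ThreadingFluxHorizonTowerProfileFormulas
import HarnessLib

/-!
# Route `UnthreadedDoor`, crux `PoloidalLiouville` (stmt-NavierStokesRegularity-1222), wall W1 — crux idea
# «flux-starved-dipoles» (ns-idea-15 g12/g13, `Cruxes/PoloidalLiouville/FluxStarvedDipoleSketch.lean`):
# ZERO NET FLUX of a divergence-free field through spheres (input (c-4) of `FluxStarvationSteady`)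

`FluxStarvedDipole.sphereFlux_eq_zero_of_divFree`: for `u ∈ C¹(ℝ³; ℝ³)` with `div u ≡ 0`, every centre `x₀` and radius
`r > 0`, `∫_{S²} ⟪u(x₀ + rα), α⟫ dσ(α) = 0` (`σ = volume.toSphere`, the surface measure used by
`Literature.Analysis.FluidPDE.SphereIntegral`).  Gauss's theorem on balls is not in Mathlib; the proof here is: for every
radial test function `θ(x) = G(‖x − x₀‖²)`, whole-space integration by parts (`WholeSpaceIBP`) gives `∫ ⟪u, ∇θ⟫ = −∫ θ div u = 0`;
in polar coordinates about `x₀` (`integral_eq_integral_Ioi_sphereIntegral`) this reads `∫₀^∞ 2G′(ρ²) ρ³ Φ(ρ) dρ = 0` with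
`Φ(ρ)` the flux density; taking `G` a primitive of a bump concentrated at `ρ² = r²` and using the continuity of `Φ` forces
`Φ(r) = 0`.  Together with `…FluxStarvedDipoleTangencyOfZeroFlux` (p837414) this leaves, for the typed Prop `FluxStarvationSteady`,
only the latitude-independence identity `(a − r a′)M = −r²ℓ` (card §Proof step 3).

HONEST LABEL: a reusable calculus lemma; information-grade for W1 (movement 0); `FluxStarvationSteady`, K1, `PoloidalLiouville`
(1222), its wall and the summit stay OPEN; NO Navier–Stokes regularity statement is proved.
`--supports stmt-NavierStokesRegularity-1222` (helper).  [folklore]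
-/

noncomputable section

-- the summit and its single sub-problem share the name (CONVENTIONS §1)
set_option linter.dupNamespace false

open Set Filter Topology MeasureTheory Metric InnerProductSpace
open scoped RealInnerProductSpace
open Literature.Analysis.FluidPDE

namespace Summit.NavierStokesRegularity.NavierStokesRegularity.Theorems.PoloidalLiouville.FluxStarvedDipole

/-- Continuity in the radius of the flux density `ρ ↦ ∫_{S²} ⟪u(x₀ + ρα), α⟫ dσ(α)` for continuous `u`. [folklore] -/
theorem continuous_sphereFlux {u : EuclideanSpace ℝ (Fin 3) → EuclideanSpace ℝ (Fin 3)} (hu : Continuous u)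
    (x₀ : EuclideanSpace ℝ (Fin 3)) :
    Continuous fun ρ : ℝ => ∫ α : sphere (0 : EuclideanSpace ℝ (Fin 3)) 1,
      ⟪u (x₀ + ρ • (α : EuclideanSpace ℝ (Fin 3))), (α : EuclideanSpace ℝ (Fin 3))⟫
        ∂(volume : Measure (EuclideanSpace ℝ (Fin 3))).toSphere := by
  have hpt : Continuous fun p : ℝ × sphere (0 : EuclideanSpace ℝ (Fin 3)) 1 =>
      x₀ + p.1 • (p.2 : EuclideanSpace ℝ (Fin 3)) :=
    continuous_const.add (continuous_fst.smul (continuous_subtype_val.comp continuous_snd))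
  have hF : Continuous (Function.uncurry fun (ρ : ℝ) (α : sphere (0 : EuclideanSpace ℝ (Fin 3)) 1) =>
      ⟪u (x₀ + ρ • (α : EuclideanSpace ℝ (Fin 3))), (α : EuclideanSpace ℝ (Fin 3))⟫) :=
    (hu.comp hpt).inner (continuous_subtype_val.comp continuous_snd)
  have h := continuous_parametric_integral_of_continuous
    (μ := (volume : Measure (EuclideanSpace ℝ (Fin 3))).toSphere) hF isCompact_univ
  simp only [Measure.restrict_univ] at h
  exact h

/-- A primitive of a bump: for `ψ` continuous, `G(σ) = ∫_{a}^{σ} ψ − C` is `C¹` with `G′ = ψ`. [folklore] -/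
theorem primitive_contDiff_one {ψ : ℝ → ℝ} (hψ : Continuous ψ) (a C : ℝ) :
    ContDiff ℝ 1 (fun σ => (∫ τ in a..σ, ψ τ) - C) ∧
      ∀ σ, HasDerivAt (fun σ => (∫ τ in a..σ, ψ τ) - C) (ψ σ) σ := by
  have hd : ∀ σ, HasDerivAt (fun σ => (∫ τ in a..σ, ψ τ) - C) (ψ σ) σ := fun σ =>
    (intervalIntegral.integral_hasDerivAt_right (hψ.intervalIntegrable _ _)
      (hψ.stronglyMeasurableAtFilter _ _) hψ.continuousAt).sub_const C
  refine ⟨?_, hd⟩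
  rw [contDiff_one_iff_deriv]
  refine ⟨fun σ => (hd σ).differentiableAt, ?_⟩
  have : deriv (fun σ => (∫ τ in a..σ, ψ τ) - C) = ψ := funext fun σ => (hd σ).deriv
  rw [this]
  exact hψ

/-- **ZERO NET FLUX THROUGH SPHERES.**  For `u ∈ C¹(ℝ³; ℝ³)` divergence free, `x₀ ∈ ℝ³` and `r > 0`:
`∫_{S²} ⟪u(x₀ + rα), α⟫ dσ(α) = 0`. [folklore] -/
theorem sphereFlux_eq_zero_of_divFree (u : EuclideanSpace ℝ (Fin 3) → EuclideanSpace ℝ (Fin 3))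
    (hu : ContDiff ℝ 1 u) (hdiv : Literature.Analysis.FluidPDE.VectorCalculus.IsDivFree u)
    (x₀ : EuclideanSpace ℝ (Fin 3)) {r : ℝ} (hr : 0 < r) :
    ∫ α : sphere (0 : EuclideanSpace ℝ (Fin 3)) 1,
        ⟪u (x₀ + r • (α : EuclideanSpace ℝ (Fin 3))), (α : EuclideanSpace ℝ (Fin 3))⟫
          ∂(volume : Measure (EuclideanSpace ℝ (Fin 3))).toSphere = 0 := by
  -- the flux density and its continuity
  set Φ : ℝ → ℝ := fun ρ => ∫ α : sphere (0 : EuclideanSpace ℝ (Fin 3)) 1,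
      ⟪u (x₀ + ρ • (α : EuclideanSpace ℝ (Fin 3))), (α : EuclideanSpace ℝ (Fin 3))⟫
        ∂(volume : Measure (EuclideanSpace ℝ (Fin 3))).toSphere with hΦ
  have hΦc : Continuous Φ := continuous_sphereFlux hu.continuous x₀
  show Φ r = 0
  by_contra hne
  -- a neighbourhood of `r` on which `Φ r * Φ ρ > 0`
  have hprod : ContinuousAt (fun ρ => Φ r * Φ ρ) r := (continuousAt_const.mul hΦc.continuousAt)
  have hpos0 : 0 < Φ r * Φ r := mul_self_pos.mpr hne
  obtain ⟨δ, hδ, hball⟩ := Metric.eventually_nhds_iff.mp (hprod.eventually (lt_mem_nhds hpos0))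
  -- the bump in the variable `σ = ρ²`, concentrated at `r²`, supported in `(r² − δ′, r² + δ′)` with `δ′ ≤ r·min δ r`
  set δ' : ℝ := r * min δ r / 2 with hδ'
  have hmin : 0 < min δ r := lt_min hδ hr
  have hδ'pos : 0 < δ' := by rw [hδ']; positivity
  have hδ'lt : δ' < r ^ 2 := by
    rw [hδ']
    have h1 : min δ r ≤ r := min_le_right _ _
    nlinarith
  let ψ : ContDiffBump (r ^ 2) := ⟨δ' / 2, δ', by linarith, by linarith⟩
  have hψc : Continuous ψ := ψ.continuous
  have hψnn : ∀ σ, 0 ≤ ψ σ := fun σ => ψ.nonneg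
  have hψ0 : ∀ σ, δ' ≤ |σ - r ^ 2| → ψ σ = 0 := fun σ hσ => ψ.zero_of_le_dist (by rwa [Real.dist_eq])
  -- where the bump is non-zero, `ρ` is `δ`-close to `r` (for `ρ > 0`)
  have hclose : ∀ ρ : ℝ, 0 < ρ → ψ (ρ ^ 2) ≠ 0 → dist ρ r < δ := by
    intro ρ hρ hψρ
    have h1 : |ρ ^ 2 - r ^ 2| < δ' := by
      by_contra h; exact hψρ (hψ0 _ (not_lt.mp h))
    have h2 : |ρ - r| * (ρ + r) < δ' := by
      have : ρ ^ 2 - r ^ 2 = (ρ - r) * (ρ + r) := by ring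
      rw [this, abs_mul, abs_of_pos (by linarith : 0 < ρ + r)] at h1
      exact h1
    have h3 : |ρ - r| * r < r * min δ r := by
      have h4 : |ρ - r| * r ≤ |ρ - r| * (ρ + r) :=
        mul_le_mul_of_nonneg_left (by linarith) (abs_nonneg _)
      have h5 : δ' ≤ r * min δ r := by rw [hδ']; nlinarith
      linarith
    have h6 : |ρ - r| < min δ r := by nlinarith [abs_nonneg (ρ - r)]
    rw [Real.dist_eq]
    exact lt_of_lt_of_le h6 (min_le_left _ _)
  -- the radial test function `θ(x) = G(‖x − x₀‖²)`, `G` a primitive of `ψ` vanishing beyond the bump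
  set a : ℝ := r ^ 2 - δ' with ha
  set b : ℝ := r ^ 2 + δ' with hb
  set G : ℝ → ℝ := fun σ => (∫ τ in a..σ, ψ τ) - ∫ τ in a..b, ψ τ with hG
  obtain ⟨hG1, hGd⟩ := primitive_contDiff_one hψc a (∫ τ in a..b, ψ τ)
  have hGzero : ∀ σ, b ≤ σ → G σ = 0 := by
    intro σ hσ
    have hsplit : ∫ τ in a..σ, ψ τ = (∫ τ in a..b, ψ τ) + ∫ τ in b..σ, ψ τ :=
      (intervalIntegral.integral_add_adjacent_intervals (hψc.intervalIntegrable _ _)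
        (hψc.intervalIntegrable _ _)).symm
    have hvan : ∫ τ in b..σ, ψ τ = 0 := by
      rw [intervalIntegral.integral_congr (g := fun _ => (0 : ℝ)) ?_, intervalIntegral.integral_zero]
      intro τ hτ
      rw [uIcc_of_le hσ] at hτ
      refine hψ0 τ ?_
      rw [abs_of_nonneg (by rw [hb] at hτ; linarith [hτ.1])]
      rw [hb] at hτ; linarith [hτ.1]
    show (∫ τ in a..σ, ψ τ) - ∫ τ in a..b, ψ τ = 0
    rw [hsplit, hvan]; ring
  set θ : EuclideanSpace ℝ (Fin 3) → ℝ := fun x => G (‖x - x₀‖ ^ 2) with hθ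
  have hθ1 : ContDiff ℝ 1 θ := hG1.comp ((contDiff_id.sub contDiff_const).norm_sq ℝ)
  have hθsupp : HasCompactSupport θ := by
    refine HasCompactSupport.intro (isCompact_closedBall x₀ (Real.sqrt b)) fun x hx => ?_
    have hxb : b ≤ ‖x - x₀‖ ^ 2 := by
      rw [mem_closedBall, dist_eq_norm, not_le] at hx
      have hb0 : 0 ≤ b := by rw [hb]; positivity
      nlinarith [Real.sq_sqrt hb0, Real.sqrt_nonneg b, norm_nonneg (x - x₀)]
    exact hGzero _ hxb
  -- the gradient of the test function
  have hgradθ : ∀ x, gradient θ x = (2 * ψ (‖x - x₀‖ ^ 2)) • (x - x₀) := by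
    intro x
    have hFd : HasFDerivAt (fun w : EuclideanSpace ℝ (Fin 3) => G (‖w‖ ^ 2))
        (fderiv ℝ (fun w : EuclideanSpace ℝ (Fin 3) => G (‖w‖ ^ 2)) (x - x₀)) (x - x₀) :=
      (hasFDerivAt_comp_norm_sq (hGd (‖x - x₀‖ ^ 2))).differentiableAt.hasFDerivAt
    have hsub : HasFDerivAt (fun y : EuclideanSpace ℝ (Fin 3) => y - x₀)
        (ContinuousLinearMap.id ℝ (EuclideanSpace ℝ (Fin 3))) x := (hasFDerivAt_id x).sub_const x₀
    have hc : HasFDerivAt θ ((fderiv ℝ (fun w : EuclideanSpace ℝ (Fin 3) => G (‖w‖ ^ 2)) (x - x₀)).comp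
        (ContinuousLinearMap.id ℝ (EuclideanSpace ℝ (Fin 3)))) x := by
      rw [hθ]; exact hFd.comp x hsub
    rw [ContinuousLinearMap.comp_id] at hc
    have h1 : gradient θ x = gradient (fun z : EuclideanSpace ℝ (Fin 3) => G (‖z‖ ^ 2)) (x - x₀) := by
      simp only [gradient, hc.fderiv]
    rw [h1, HorizonTower.gradient_comp_norm_sq (hGd _)]
  -- integration by parts on the whole space: `∫ ⟪u, ∇θ⟫ = 0`
  have hIBP := integral_mul_divergence_add_eq_zero_left hθ1 hu hθsupp
  have hdiv0 : (fun x => θ x * VectorCalculus.divergence u x) = fun _ => 0 := by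
    funext x; rw [hdiv x, mul_zero]
  rw [hdiv0, integral_zero, zero_add] at hIBP
  simp_rw [hgradθ] at hIBP
  -- recentre at `x₀` and pass to polar coordinates
  set f : EuclideanSpace ℝ (Fin 3) → ℝ := fun z => ⟪u (x₀ + z), (2 * ψ (‖z‖ ^ 2)) • z⟫ with hf
  have hrec : ∫ x, ⟪u x, (2 * ψ (‖x - x₀‖ ^ 2)) • (x - x₀)⟫ = ∫ z, f z := by
    rw [← integral_sub_right_eq_self f x₀]
    refine integral_congr_ae (Eventually.of_forall fun x => ?_)
    simp only [hf, add_sub_cancel]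
  have hfc : Continuous f :=
    (hu.continuous.comp (continuous_const.add continuous_id)).inner
      ((continuous_const.mul (hψc.comp (continuous_norm.pow 2))).smul continuous_id)
  have hfsupp : HasCompactSupport f := by
    refine HasCompactSupport.intro (isCompact_closedBall (0 : EuclideanSpace ℝ (Fin 3)) (Real.sqrt b))
      fun z hz => ?_
    have hzb : b ≤ ‖z‖ ^ 2 := by
      rw [mem_closedBall, dist_zero_right, not_le] at hz
      have hb0 : 0 ≤ b := by rw [hb]; positivity
      nlinarith [Real.sq_sqrt hb0, Real.sqrt_nonneg b, norm_nonneg z]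
    have hψz : ψ (‖z‖ ^ 2) = 0 := hψ0 _ (by rw [abs_of_nonneg (by rw [hb] at hzb; linarith)]; rw [hb] at hzb; linarith)
    simp only [hf, hψz, mul_zero, zero_smul, inner_zero_right]
  have hfi : Integrable f := hfc.integrable_of_hasCompactSupport hfsupp
  have hpolar := integral_eq_integral_Ioi_sphereIntegral (volume : Measure (EuclideanSpace ℝ (Fin 3))) hfi
  rw [hrec, hpolar, finrank_euclideanSpace_fin] at hIBP
  -- the sphere integrals: `sphereIntegral f ρ = 2 ψ(ρ²) ρ Φ(ρ)` for `ρ > 0`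
  have hsph : ∀ ρ : ℝ, 0 < ρ → sphereIntegral volume f ρ = 2 * ψ (ρ ^ 2) * ρ * Φ ρ := by
    intro ρ hρ
    rw [sphereIntegral_def, hΦ]
    simp only
    rw [← integral_const_mul]
    refine integral_congr_ae (Eventually.of_forall fun α => ?_)
    have hα : ‖(α : EuclideanSpace ℝ (Fin 3))‖ = 1 := norm_eq_of_mem_sphere α
    simp only [hf]
    rw [norm_smul, hα, mul_one, Real.norm_eq_abs, abs_of_pos hρ, real_inner_smul_right, real_inner_smul_right]
    ring
  have hI : ∫ ρ in Ioi (0 : ℝ), (ρ ^ (3 - 1)) • sphereIntegral volume f ρ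
      = ∫ ρ in Ioi (0 : ℝ), ρ ^ 2 * (2 * ψ (ρ ^ 2) * ρ * Φ ρ) := by
    refine setIntegral_congr_fun measurableSet_Ioi fun ρ hρ => ?_
    simp only [smul_eq_mul]
    rw [hsph ρ hρ]
  rw [hI] at hIBP
  -- the integrand `g(ρ) = Φ(r)·ρ²·2ψ(ρ²)ρ·Φ(ρ)` is continuous, ≥ 0 on `(0,∞)`, and `> 0` at `ρ = r`
  set g : ℝ → ℝ := fun ρ => Φ r * (ρ ^ 2 * (2 * ψ (ρ ^ 2) * ρ * Φ ρ)) with hg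
  have hgc : Continuous g :=
    continuous_const.mul ((continuous_id.pow 2).mul
      (((continuous_const.mul (hψc.comp (continuous_id.pow 2))).mul continuous_id).mul hΦc))
  have hgnn : ∀ ρ, 0 < ρ → 0 ≤ g ρ := by
    intro ρ hρ
    by_cases hψρ : ψ (ρ ^ 2) = 0
    · simp only [hg, hψρ, mul_zero, zero_mul]; exact le_rfl
    · have hΦρ : 0 < Φ r * Φ ρ := hball (hclose ρ hρ hψρ)
      have : g ρ = (Φ r * Φ ρ) * (2 * ρ ^ 3 * ψ (ρ ^ 2)) := by simp only [hg]; ring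
      rw [this]
      exact mul_nonneg hΦρ.le (mul_nonneg (by positivity) (hψnn _))
  have hgr : 0 < g r := by
    have hψr : ψ (r ^ 2) = 1 :=
      ψ.one_of_mem_closedBall (by rw [mem_closedBall, dist_self]; exact le_of_lt ψ.rIn_pos)
    have : g r = (Φ r * Φ r) * (2 * r ^ 3 * ψ (r ^ 2)) := by simp only [hg]; ring
    rw [this, hψr, mul_one]
    positivity
  -- `g` has compact support inside `(0, ∞)`: it vanishes unless `|ρ² − r²| < δ′`
  have hgsupp : HasCompactSupport g := by
    refine HasCompactSupport.intro (K := Icc (-Real.sqrt b) (Real.sqrt b)) isCompact_Icc fun ρ hρ => ?_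
    have hρb : b ≤ ρ ^ 2 := by
      rw [mem_Icc, not_and_or, not_le, not_le] at hρ
      have hb0 : 0 ≤ b := by rw [hb]; positivity
      rcases hρ with h | h <;> nlinarith [Real.sq_sqrt hb0, Real.sqrt_nonneg b]
    have hψρ : ψ (ρ ^ 2) = 0 := hψ0 _ (by rw [abs_of_nonneg (by rw [hb] at hρb; linarith)]; rw [hb] at hρb; linarith)
    simp only [hg, hψρ, mul_zero, zero_mul]
  have hgi : IntegrableOn g (Ioi 0) := (hgc.integrable_of_hasCompactSupport hgsupp).integrableOn
  -- hence `∫_{(0,∞)} g > 0`, contradicting `Φ(r) · 0 = 0`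
  have hIpos : 0 < ∫ ρ in Ioi (0 : ℝ), g ρ := by
    rw [setIntegral_pos_iff_support_of_nonneg_ae ?_ hgi]
    · -- the support contains a neighbourhood of `r` within `(0,∞)`
      obtain ⟨ε, hε, hεball⟩ := Metric.eventually_nhds_iff.mp (hgc.continuousAt.eventually (lt_mem_nhds hgr))
      have hsub : Ioo r (r + min ε r) ⊆ Function.support g ∩ Ioi 0 := by
        intro ρ hρ
        refine ⟨?_, lt_trans hr hρ.1⟩
        rw [Function.mem_support]
        have : dist ρ r < ε := by
          rw [Real.dist_eq, abs_of_pos (by linarith [hρ.1])]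
          linarith [hρ.2, min_le_left ε r]
        exact (hεball this).ne'
      calc (0 : ENNReal) < volume (Ioo r (r + min ε r)) := by
            rw [Real.volume_Ioo]; exact ENNReal.ofReal_pos.mpr (by linarith [lt_min hε hr])
        _ ≤ volume (Function.support g ∩ Ioi 0) := measure_mono hsub
    · filter_upwards [ae_restrict_mem measurableSet_Ioi] with ρ hρ
      exact hgnn ρ hρ
  have hzero : ∫ ρ in Ioi (0 : ℝ), g ρ = 0 := by
    simp only [hg]
    rw [integral_const_mul, hIBP, mul_zero]
  exact absurd hzero hIpos.ne'

end Summit.NavierStokesRegularity.NavierStokesRegularity.Theorems.PoloidalLiouville.FluxStarvedDipole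

end
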